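import Literature.MathematicalPhysics.QuantumLattice.ApproximatingHamiltonianProofs
import HarnessLib

/-!
# Temperature dependence of the free energy of a finite quantum system

Topic `Literature/MathematicalPhysics/QuantumLattice` (companion to the thermal toolkit of
`DuhamelTwoPoint.lean` / `ApproximatingHamiltonianProofs.lean`: Peierls–Bogoliubov, Lipschitz and
monotonicity bounds for `log Z_β(H) = log tr e^{-βH}` in the HAMILTONIAN; this file adds the
elementary facts about the dependence on the INVERSE TEMPERATURE `β`). Everything is proved;
no named facts. For a Hermitian matrix `H` on a nonempty finite index type:

* `log_sum_exp_div_antitone` — for reals `λᵢ` and `0 < β' ≤ β`,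
  `β⁻¹ log Σᵢ e^{-βλᵢ} ≤ β'⁻¹ log Σᵢ e^{-β'λᵢ}` (monotonicity of `ℓᵖ` norms of a positive vector);
* `log_partitionFn_div_antitone` — hence `β ↦ β⁻¹ log Z_β(H)` is antitone on `(0, ∞)`: the
  pressure does not increase as the temperature is lowered (equivalently, the von Neumann entropy of
  the Gibbs state is non-negative);
* `log_partitionFn_sub_mul_energy_le` — convexity of `β ↦ log Z_β(H)` in supporting-line form:
  `log Z_{β'}(H) − (β − β') Re⟨H⟩_{β'} ≤ log Z_β(H)` for `β' > 0` and every real `β`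
  (Peierls–Bogoliubov with the perturbation `((β − β')/β') H`);
* `pressure_sub_pressure_le_entropy` — the pressure increment between two temperatures is paid in
  entropy: `β'⁻¹ log Z_{β'} − β⁻¹ log Z_β ≤ ((β − β')/(ββ')) · S_{β'}`,
  `S_{β'} = log Z_{β'} + β' Re⟨H⟩_{β'}` the entropy of the Gibbs state at `β'`;
* `entropy_le_two_mul_log_partitionFn_half_sub` — conversely (the same supporting line, read at
  `β/2`) `S_β ≤ 2 log Z_{β/2}(H) − log Z_β(H)`; with the previous item at `β' = β/2` this sandwiches
  the dyadic pressure increment between the entropies at the two ends,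
  `S_β ≤ 2 log Z_{β/2} − log Z_β ≤ S_{β/2}`.

* `partitionFn_zero_re`, `re_gibbsState_zero_self` — the infinite-temperature anchor: `Z_0 = |n|`,
  `Re⟨H⟩_0 = Re tr H / |n|`; `log_card_sub_mul_le_log_partitionFn` — the supporting line at `β' = 0`:
  `log |n| − β · Re tr H/|n| ≤ log Z_β(H)` (Jensen for `exp`), and
  `log_partitionFn_sub_mul_energy_le_of_nonneg` — the supporting line for every `β' ≥ 0`;
* `log_partitionFn_sub_sum_mul_le` / `log_partitionFn_le_sub_sum_mul` — **thermodynamic integration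
  with one-sided energy data (β-staircases)**: along a grid `b 0 ≤ b 1 ≤ … ≤ b N` (`b 0 ≥ 0`),
  energy CEILINGS `Re⟨H⟩_{b i} ≤ E i` give the pressure FLOOR
  `log Z_{b 0} − Σ_{i<N} (b(i+1) − b i)·E i ≤ log Z_{b N}` (tangents at the left endpoints), and energy
  FLOORS `E' (i+1) ≤ Re⟨H⟩_{b(i+1)}` give the pressure CEILING
  `log Z_{b N} ≤ log Z_{b 0} − Σ_{i<N} (b(i+1) − b i)·E' (i+1)` (tangents at the right endpoints) — the
  one-sided Riemann sums of `log Z_β = log Z_{β₀} − ∫_{β₀}^{β} ⟨H⟩_{β'} dβ'` licensed by convexity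
  alone; with `b 0 = 0` the anchor is the exact `log |n|`.

These are the "soft" inputs of temperature-for-source exchange arguments (trading a symmetry-breaking
source above the temperature for a hotter system), e.g. in the Hubbard routes `ThermalWedge`.

Sources: standard thermodynamic convexity (Ruelle, *Statistical Mechanics: Rigorous Results*
(1969) §2.5–2.6: convexity of `log Z` in the interaction parameters and in `β`; Simon, *The
Statistical Mechanics of Lattice Gases* I (1993) §II.8); the finite-dimensional matrix statements
below are folklore. Tree search: `lean search 'antitone|Antitone'` in `QuantumLattice` — nothing on
`partitionFn`; `HeisenbergOrderDLSProofs.partitionFn_ofReal_smul` (`Z_β(J·H) = Z_{βJ}(H)`) is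
re-derived inline (one `rw`) to keep the imports light.
-/

noncomputable section

open scoped ComplexOrder
open Matrix Finset

namespace Literature.MathematicalPhysics.QuantumLattice

/-- **`ℓᵖ`-monotonicity of Boltzmann sums**: for reals `λᵢ` on a nonempty finite index type and
`0 < β' ≤ β`, `β⁻¹ log Σᵢ e^{-βλᵢ} ≤ β'⁻¹ log Σᵢ e^{-β'λᵢ}`. Proof: shift the levels so that the
hotter sum is `1`; then every shifted level is `≥ 0`, so each colder Boltzmann factor is smaller.
[folklore] -/
theorem log_sum_exp_div_antitone {ι : Type*} [Fintype ι] [Nonempty ι] (lam : ι → ℝ) {β β' : ℝ}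
    (hβ' : 0 < β') (hle : β' ≤ β) :
    Real.log (∑ i, Real.exp (-β * lam i)) / β ≤ Real.log (∑ i, Real.exp (-β' * lam i)) / β' := by
  have hβ : 0 < β := lt_of_lt_of_le hβ' hle
  set Z' : ℝ := ∑ i, Real.exp (-β' * lam i) with hZ'
  have hZ'pos : 0 < Z' := Finset.sum_pos (fun i _ => Real.exp_pos _) Finset.univ_nonempty
  set M : ℝ := Real.log Z' / β' with hM
  have hlogZ' : Real.log Z' = β' * M := by rw [hM]; field_simp
  have hlev : ∀ i, -lam i ≤ M := by
    intro i
    have h1 : Real.exp (-β' * lam i) ≤ Z' :=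
      Finset.single_le_sum (f := fun j => Real.exp (-β' * lam j)) (fun j _ => (Real.exp_pos _).le)
        (Finset.mem_univ i)
    have h2 : -β' * lam i ≤ Real.log Z' := by
      rw [← Real.log_exp (-β' * lam i)]
      exact Real.log_le_log (Real.exp_pos _) h1
    rw [hlogZ'] at h2
    nlinarith
  have hsum : ∑ i, Real.exp (-β * lam i) ≤ Real.exp (β * M) := by
    calc ∑ i, Real.exp (-β * lam i)
        ≤ ∑ i, Real.exp (-β' * lam i) * Real.exp ((β - β') * M) := by
          refine Finset.sum_le_sum fun i _ => ?_
          rw [← Real.exp_add]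
          refine Real.exp_le_exp.2 ?_
          have : (β - β') * (-lam i) ≤ (β - β') * M :=
            mul_le_mul_of_nonneg_left (hlev i) (by linarith)
          nlinarith
      _ = Z' * Real.exp ((β - β') * M) := by rw [← Finset.sum_mul]
      _ = Real.exp (β * M) := by
          rw [← Real.exp_log hZ'pos, ← Real.exp_add, hlogZ']
          ring_nf
  have hpos : 0 < ∑ i, Real.exp (-β * lam i) :=
    Finset.sum_pos (fun i _ => Real.exp_pos _) Finset.univ_nonempty
  have hlog : Real.log (∑ i, Real.exp (-β * lam i)) ≤ β * M := by
    have := Real.log_le_log hpos hsum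
    rwa [Real.log_exp] at this
  rw [div_le_iff₀ hβ, hM]
  linarith

variable {n : Type*} [Fintype n] [DecidableEq n] [Nonempty n]

/-- **The pressure is antitone in `β`**: for Hermitian `H` and `0 < β' ≤ β`,
`β⁻¹ log Z_β(H) ≤ β'⁻¹ log Z_{β'}(H)` (`Z_β = tr e^{-βH} = Σᵢ e^{-βEᵢ}` and
`log_sum_exp_div_antitone`). Equivalently `d/dβ (β⁻¹ log Z_β) = -β⁻² S_β ≤ 0` with `S_β ≥ 0` the
von Neumann entropy of the Gibbs state. [folklore] -/
theorem log_partitionFn_div_antitone {H : Matrix n n ℂ} (hH : H.IsHermitian) {β β' : ℝ}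
    (hβ' : 0 < β') (hle : β' ≤ β) :
    Real.log (partitionFn β H).re / β ≤ Real.log (partitionFn β' H).re / β' := by
  have h1 : ∀ b : ℝ, (partitionFn b H).re = ∑ i, Real.exp (-b * hH.eigenvalues i) := by
    intro b
    rw [partitionFn_eq_sum_exp b hH, Complex.re_sum]
    simp only [Complex.ofReal_re]
  rw [h1, h1]
  exact log_sum_exp_div_antitone _ hβ' hle

/-- **Convexity of `β ↦ log Z_β(H)` (supporting line at `β'`)**: for Hermitian `H`, `β' > 0` and
every real `β`, `log Z_{β'}(H) − (β − β') Re⟨H⟩_{β'} ≤ log Z_β(H)`, where `⟨·⟩_{β'}` is the Gibbs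
state at `β'`. This is the Peierls–Bogoliubov inequality `log Z(K) − β'⟨W⟩_K ≤ log Z(K + W)` at
inverse temperature `β'` with `K = H`, `W = ((β − β')/β')·H`, since `Z_{β'}((β/β')H) = Z_β(H)`.
[folklore] -/
theorem log_partitionFn_sub_mul_energy_le {H : Matrix n n ℂ} (hH : H.IsHermitian) (β : ℝ)
    {β' : ℝ} (hβ' : 0 < β') :
    Real.log (partitionFn β' H).re - (β - β') * (gibbsState β' H H).re ≤
      Real.log (partitionFn β H).re := by
  set r : ℝ := (β - β') / β' with hr
  have hW : ((r : ℂ) • H).IsHermitian := by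
    refine IsHermitian.smul hH ?_
    rw [isSelfAdjoint_iff, Complex.star_def, Complex.conj_ofReal]
  have hPB := log_partitionFn_sub_le_log_partitionFn_add hH hW β'
  have hsum : H + (r : ℂ) • H = (((1 + r : ℝ)) : ℂ) • H := by
    rw [Complex.ofReal_add, Complex.ofReal_one, add_smul, one_smul]
  have hβr : β' * (1 + r) = β := by rw [hr]; field_simp; ring
  have hZ : partitionFn β' (H + (r : ℂ) • H) = partitionFn β H := by
    rw [hsum, partitionFn, partitionFn, gibbsWeight, gibbsWeight, smul_smul, neg_mul,
      ← Complex.ofReal_mul, hβr]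
  have hst : (gibbsState β' H ((r : ℂ) • H)).re = r * (gibbsState β' H H).re := by
    rw [LinearMap.map_smul_of_tower, smul_eq_mul, Complex.re_ofReal_mul]
  rw [hZ, hst] at hPB
  have hβ'r : β' * r = β - β' := by rw [hr]; field_simp
  calc Real.log (partitionFn β' H).re - (β - β') * (gibbsState β' H H).re
      = Real.log (partitionFn β' H).re - β' * (r * (gibbsState β' H H).re) := by
        rw [← mul_assoc, hβ'r]
    _ ≤ Real.log (partitionFn β H).re := hPB

/-- **A pressure increment is paid in entropy**: for Hermitian `H` and `β, β' > 0`,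
`β'⁻¹ log Z_{β'} − β⁻¹ log Z_β ≤ ((β − β')/(β β')) · S_{β'}`, where
`S_{β'} = log Z_{β'} + β' Re⟨H⟩_{β'}` is the von Neumann entropy of the Gibbs state at `β'`
(divide `log_partitionFn_sub_mul_energy_le` by `β`). For `β' = β/2` the factor is `1/β`.
[folklore] -/
theorem pressure_sub_pressure_le_entropy {H : Matrix n n ℂ} (hH : H.IsHermitian) {β β' : ℝ}
    (hβ : 0 < β) (hβ' : 0 < β') :
    Real.log (partitionFn β' H).re / β' - Real.log (partitionFn β H).re / β ≤
      (β - β') / (β * β') *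
        (Real.log (partitionFn β' H).re + β' * (gibbsState β' H H).re) := by
  have key := log_partitionFn_sub_mul_energy_le hH β hβ'
  have h1 : Real.log (partitionFn β H).re / β ≥
      (Real.log (partitionFn β' H).re - (β - β') * (gibbsState β' H H).re) / β :=
    div_le_div_of_nonneg_right key hβ.le
  calc Real.log (partitionFn β' H).re / β' - Real.log (partitionFn β H).re / β
      ≤ Real.log (partitionFn β' H).re / β' -
          (Real.log (partitionFn β' H).re - (β - β') * (gibbsState β' H H).re) / β := by
        linarith
    _ = (β - β') / (β * β') *
        (Real.log (partitionFn β' H).re + β' * (gibbsState β' H H).re) := by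
        field_simp
        ring

/-- **Entropy is dominated by the dyadic pressure increment**: for Hermitian `H` and real `β`,
`S_β = log Z_β + β Re⟨H⟩_β ≤ 2 log Z_{β/2}(H) − log Z_β(H)` (the supporting line of the convex
`β ↦ log Z_β` at `β`, evaluated at `β/2`; needs `β > 0`). Together with
`pressure_sub_pressure_le_entropy` (at `β' = β/2`): `S_β ≤ 2 log Z_{β/2} − log Z_β ≤ S_{β/2}`.
[folklore] -/
theorem entropy_le_two_mul_log_partitionFn_half_sub {H : Matrix n n ℂ} (hH : H.IsHermitian)
    {β : ℝ} (hβ : 0 < β) :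
    Real.log (partitionFn β H).re + β * (gibbsState β H H).re ≤
      2 * Real.log (partitionFn (β / 2) H).re - Real.log (partitionFn β H).re := by
  have key := log_partitionFn_sub_mul_energy_le hH (β / 2) hβ
  have hrw : (β / 2 - β) * (gibbsState β H H).re = -(β / 2) * (gibbsState β H H).re := by ring
  rw [hrw] at key
  linarith

/-- **The thermal ratchet** (two temperatures, two Hamiltonians): for Hermitian `K₀, K₁` and
`0 < β₁ ≤ β`,
`(2 log Z_{β₁}(K₁) − 2 log Z_{β₁/2}(K₁) − log Z_{β₁}(K₀))/β₁ ≤ (log Z_β(K₁) − log Z_β(K₀))/β`.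
In pressure form (`p_β(K) = β⁻¹ log Z_β(K)`): the gain `p_β(K₁) − p_β(K₀)` at the colder `β` is at
least the gain at the hotter `β₁` minus the dyadic heat chord `p_{β₁/2}(K₁) − p_{β₁}(K₁)` of `K₁`.
Proof: the `K₀` pressure is antitone in `β` (`log_partitionFn_div_antitone`); the `K₁` pressure
increment from `β` to `β₁` is paid in the entropy at `β₁` (`pressure_sub_pressure_le_entropy`),
which is dominated by the dyadic increment (`entropy_le_two_mul_log_partitionFn_half_sub`), itself
non-negative. This is the "temperature-for-source" lever of the Hubbard route `ThermalWedge`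
(cruxes `TwSourcedCondensation` / `TwSourcedInertness`), where `K₁ = K₀ − h·(source)`. [folklore] -/
theorem thermalRatchet_div_le {H K : Matrix n n ℂ} (hH : H.IsHermitian) (hK : K.IsHermitian)
    {β₁ β : ℝ} (hβ₁ : 0 < β₁) (hle : β₁ ≤ β) :
    (2 * Real.log (partitionFn β₁ K).re - 2 * Real.log (partitionFn (β₁ / 2) K).re
        - Real.log (partitionFn β₁ H).re) / β₁
      ≤ (Real.log (partitionFn β K).re - Real.log (partitionFn β H).re) / β := by
  have hβ : 0 < β := lt_of_lt_of_le hβ₁ hle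
  have hβh : 0 < β₁ / 2 := half_pos hβ₁
  set L11 := Real.log (partitionFn β₁ K).re
  set L1h := Real.log (partitionFn (β₁ / 2) K).re
  set L01 := Real.log (partitionFn β₁ H).re
  set Lb1 := Real.log (partitionFn β K).re
  set Lb0 := Real.log (partitionFn β H).re
  set S := Real.log (partitionFn β₁ K).re + β₁ * (gibbsState β₁ K K).re
  have hA : Lb0 / β ≤ L01 / β₁ := log_partitionFn_div_antitone hH hβ₁ hle
  have hB : L11 / β₁ - Lb1 / β ≤ (β - β₁) / (β * β₁) * S :=
    pressure_sub_pressure_le_entropy hK hβ hβ₁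
  have hC : S ≤ 2 * L1h - L11 := entropy_le_two_mul_log_partitionFn_half_sub hK hβ₁
  have hD : L11 / β₁ ≤ L1h / (β₁ / 2) := log_partitionFn_div_antitone hK hβh (by linarith)
  have hD' : 0 ≤ 2 * L1h - L11 := by
    have h1 : L1h / (β₁ / 2) = 2 * L1h / β₁ := by field_simp
    rw [h1] at hD
    have h2 := (div_le_div_iff_of_pos_right hβ₁).mp hD
    linarith
  have hA' : Lb0 * β₁ ≤ L01 * β := (div_le_div_iff₀ hβ hβ₁).mp hA
  have hB' : L11 * β - Lb1 * β₁ ≤ (β - β₁) * S := by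
    have hpos : 0 < β * β₁ := mul_pos hβ hβ₁
    have := mul_le_mul_of_nonneg_right hB hpos.le
    have e1 : (L11 / β₁ - Lb1 / β) * (β * β₁) = L11 * β - Lb1 * β₁ := by field_simp
    have e2 : (β - β₁) / (β * β₁) * S * (β * β₁) = (β - β₁) * S := by field_simp
    rw [e1, e2] at this
    exact this
  have hC' : (β - β₁) * S ≤ (β - β₁) * (2 * L1h - L11) :=
    mul_le_mul_of_nonneg_left hC (sub_nonneg.2 hle)
  have hE : (β - β₁) * (2 * L1h - L11) ≤ β * (2 * L1h - L11) := by
    have : 0 ≤ β₁ * (2 * L1h - L11) := mul_nonneg hβ₁.le hD'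
    nlinarith
  rw [div_le_div_iff₀ hβ₁ hβ]
  nlinarith

/-- **The thermal ratchet, pressure form**: for Hermitian `H` (unsourced) and `K` (sourced) and
`0 < β₁ ≤ β`,
`[p_{β₁}(K) − p_{β₁}(H)] − [p_{β₁/2}(K) − p_{β₁}(K)] ≤ p_β(K) − p_β(H)`, `p_b(X) = b⁻¹ log Z_b(X)`. [folklore] -/
theorem pressureGain_sub_heatChord_le {H K : Matrix n n ℂ} (hH : H.IsHermitian) (hK : K.IsHermitian)
    {β₁ β : ℝ} (hβ₁ : 0 < β₁) (hle : β₁ ≤ β) :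
    (Real.log (partitionFn β₁ K).re / β₁ - Real.log (partitionFn β₁ H).re / β₁)
        - (Real.log (partitionFn (β₁ / 2) K).re / (β₁ / 2) - Real.log (partitionFn β₁ K).re / β₁)
      ≤ Real.log (partitionFn β K).re / β - Real.log (partitionFn β H).re / β := by
  have hβ : 0 < β := lt_of_lt_of_le hβ₁ hle
  have key := thermalRatchet_div_le hH hK hβ₁ hle
  have lhs : (Real.log (partitionFn β₁ K).re / β₁ - Real.log (partitionFn β₁ H).re / β₁)
        - (Real.log (partitionFn (β₁ / 2) K).re / (β₁ / 2) - Real.log (partitionFn β₁ K).re / β₁)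
      = (2 * Real.log (partitionFn β₁ K).re - 2 * Real.log (partitionFn (β₁ / 2) K).re
          - Real.log (partitionFn β₁ H).re) / β₁ := by
    field_simp
    ring
  have rhs : Real.log (partitionFn β K).re / β - Real.log (partitionFn β H).re / β =
      (Real.log (partitionFn β K).re - Real.log (partitionFn β H).re) / β := by
    field_simp
  rw [lhs, rhs]
  exact key

/-! ### The infinite-temperature anchor and thermodynamic integration with one-sided energy data -/

omit [Nonempty n] in
/-- At `β = 0` the partition function is the dimension: `Re Z_0(H) = |n|` (`e^{0} = 1`; the `β = 0` member
of the family `Z(β) = Tr e^{−βH}`). [cite: GustafsonSigal2003, §18.3 (18.12) (Z(β) = Tr e^{−βH}, read at β = 0)] -/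
theorem partitionFn_zero_re (H : Matrix n n ℂ) :
    (partitionFn 0 H).re = Fintype.card n := by
  rw [partitionFn, gibbsWeight_zero, trace_one]
  simp

omit [Nonempty n] in
/-- At `β = 0` the Gibbs state is the tracial (maximally mixed) state: `Re⟨H⟩_0 = Re tr H / |n|`.
[cite: GustafsonSigal2003, §18.3 (18.12) (ρ_T = e^{−H/T}/Z(T), read at β = 1/T = 0)] -/
theorem re_gibbsState_zero_self (H : Matrix n n ℂ) :
    (gibbsState 0 H H).re = H.trace.re / Fintype.card n := by
  rw [gibbsState_apply, gibbsWeight_zero, one_mul, partitionFn, gibbsWeight_zero, trace_one]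
  have hc : ((Fintype.card n : ℂ))⁻¹ = ((Fintype.card n : ℝ)⁻¹ : ℝ) := by push_cast; rfl
  rw [hc, Complex.re_ofReal_mul, inv_mul_eq_div]

/-- **Supporting line of `β ↦ log Z_β(H)` at `β' = 0`** (the infinite-temperature tangent): for
Hermitian `H` and every real `β`, `log |n| − β · Re tr H / |n| ≤ log Z_β(H)` — Jensen's inequality
for the convex `exp` over the eigenvalues with uniform weights,
`exp(−β · (Σᵢ λᵢ)/|n|) ≤ (Σᵢ e^{−βλᵢ})/|n|`; equivalently the Gibbs variational principle at the
maximally mixed state `ρ_0 = 1/|n|`: `log Z_β ≥ S(ρ_0) − β E(ρ_0)` (the Gibbs state minimises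
`F_T(ρ) = E(ρ) − T S(ρ)`, `F(T) = −T log Z(T)`). [cite: GustafsonSigal2003, §18.3 (18.12)–(18.13), Problem 18.9 (variational principle, trial state ρ_0 = 1/dim)] [cite: Ruelle1969, §2.5–2.6 (convexity of log Z in β)] -/
theorem log_card_sub_mul_le_log_partitionFn {H : Matrix n n ℂ} (hH : H.IsHermitian) (β : ℝ) :
    Real.log (Fintype.card n) - β * (H.trace.re / Fintype.card n) ≤
      Real.log (partitionFn β H).re := by
  have hd : (0 : ℝ) < Fintype.card n := by exact_mod_cast Fintype.card_pos
  have hZ : (partitionFn β H).re = ∑ i, Real.exp (-β * hH.eigenvalues i) := by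
    rw [partitionFn_eq_sum_exp β hH, Complex.re_sum]
    simp only [Complex.ofReal_re]
  have htr : H.trace.re = ∑ i, hH.eigenvalues i := by
    rw [hH.trace_eq_sum_eigenvalues]; norm_cast
  -- Jensen for `exp` with uniform weights `1/|n|` at the points `-β λᵢ`
  have hJ := (convexOn_exp).map_sum_le (t := Finset.univ) (w := fun _ : n => (Fintype.card n : ℝ)⁻¹)
    (p := fun i => -β * hH.eigenvalues i) (fun _ _ => inv_nonneg.2 hd.le)
    (by rw [Finset.sum_const, Finset.card_univ, nsmul_eq_mul, mul_inv_cancel₀ hd.ne'])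
    (fun _ _ => Set.mem_univ _)
  simp only [smul_eq_mul] at hJ
  have hL : ∑ i, (Fintype.card n : ℝ)⁻¹ * (-β * hH.eigenvalues i) =
      (Fintype.card n : ℝ)⁻¹ * (-β * ∑ i, hH.eigenvalues i) := by
    rw [Finset.mul_sum, Finset.mul_sum]
  have hR : ∑ i, (Fintype.card n : ℝ)⁻¹ * Real.exp (-β * hH.eigenvalues i) =
      (Fintype.card n : ℝ)⁻¹ * ∑ i, Real.exp (-β * hH.eigenvalues i) := by
    rw [Finset.mul_sum]
  rw [hL, hR] at hJ
  -- `hJ : exp ((1/|n|) (-β Σ λᵢ)) ≤ (1/|n|) Σ exp(-β λᵢ)`; take logarithms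
  have hlog := Real.log_le_log (Real.exp_pos _) hJ
  rw [Real.log_exp, Real.log_mul (inv_ne_zero hd.ne')
    (Finset.sum_pos (fun i _ => Real.exp_pos _) Finset.univ_nonempty).ne', Real.log_inv] at hlog
  rw [hZ, htr]
  have e1 : β * ((∑ i, hH.eigenvalues i) / (Fintype.card n : ℝ)) =
      -((Fintype.card n : ℝ)⁻¹ * (-β * ∑ i, hH.eigenvalues i)) := by
    field_simp
  rw [e1]
  linarith

/-- The supporting line of `β ↦ log Z_β(H)` at any `β' ≥ 0`:
`log Z_{β'}(H) − (β − β') Re⟨H⟩_{β'} ≤ log Z_β(H)` (`log_partitionFn_sub_mul_energy_le` for `β' > 0`,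
`log_card_sub_mul_le_log_partitionFn` at `β' = 0`); = the Gibbs variational principle at inverse
temperature `β` with the Gibbs state of `β'` as trial state. [cite: GustafsonSigal2003, §18.3 (18.12)–(18.13), Problem 18.9] [cite: Ruelle1969, §2.5–2.6] -/
theorem log_partitionFn_sub_mul_energy_le_of_nonneg {H : Matrix n n ℂ} (hH : H.IsHermitian) (β : ℝ)
    {β' : ℝ} (hβ' : 0 ≤ β') :
    Real.log (partitionFn β' H).re - (β - β') * (gibbsState β' H H).re ≤
      Real.log (partitionFn β H).re := by
  rcases hβ'.lt_or_eq with h | h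
  · exact log_partitionFn_sub_mul_energy_le hH β h
  · subst h
    rw [partitionFn_zero_re, re_gibbsState_zero_self, sub_zero]
    exact log_card_sub_mul_le_log_partitionFn hH β

/-- **Thermodynamic integration with energy CEILINGS (forward β-staircase ⇒ pressure FLOOR)**: for
Hermitian `H`, a grid `0 ≤ b 0 ≤ b 1 ≤ …` (`b` monotone) and numbers `E i` with `Re⟨H⟩_{b i} ≤ E i`
for `i < N`: `log Z_{b 0}(H) − Σ_{i<N} (b(i+1) − b i)·E i ≤ log Z_{b N}(H)`. Proof: telescope the
supporting lines at the LEFT endpoints, `log Z_{b(i+1)} ≥ log Z_{b i} − (b(i+1) − b i) Re⟨H⟩_{b i}`.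
This is the left Riemann sum of `log Z_β = log Z_{β₀} − ∫ ⟨H⟩ dβ'` made rigorous by convexity alone
(`⟨H⟩_β` is antitone in `β`); with `b 0 = 0`, `log Z_{b 0} = log |n|` (`partitionFn_zero_re`). Our
telescoping of the cited variational inequality (one trial Gibbs state `ρ_{b i}` per grid cell).
[cite: GustafsonSigal2003, §18.3 (18.12)–(18.13), Problem 18.9 (F_T(ρ) ≥ F(T) for every trial ρ; here ρ = ρ_{b i}, T = 1/b(i+1))] [cite: Ruelle1969, §2.5–2.6 (convexity of log Z in β)] -/
theorem log_partitionFn_sub_sum_mul_le {H : Matrix n n ℂ} (hH : H.IsHermitian) {b : ℕ → ℝ}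
    (hb0 : 0 ≤ b 0) (hb : Monotone b) {E : ℕ → ℝ} (N : ℕ)
    (hE : ∀ i < N, (gibbsState (b i) H H).re ≤ E i) :
    Real.log (partitionFn (b 0) H).re - ∑ i ∈ Finset.range N, (b (i + 1) - b i) * E i ≤
      Real.log (partitionFn (b N) H).re := by
  induction N with
  | zero => simp
  | succ N ih =>
    have hih := ih (fun i hi => hE i (Nat.lt_succ_of_lt hi))
    have hbN : 0 ≤ b N := hb0.trans (hb (Nat.zero_le N))
    have htan := log_partitionFn_sub_mul_energy_le_of_nonneg hH (b (N + 1)) hbN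
    have hΔ : 0 ≤ b (N + 1) - b N := sub_nonneg.2 (hb (Nat.le_succ N))
    have hEN := mul_le_mul_of_nonneg_left (hE N (Nat.lt_succ_self N)) hΔ
    rw [Finset.sum_range_succ]
    linarith

/-- **Thermodynamic integration with energy FLOORS (backward β-staircase ⇒ pressure CEILING)**: for
Hermitian `H`, a monotone grid `0 ≤ b 0 ≤ b 1 ≤ …` and numbers `E' i` with `E' (i+1) ≤ Re⟨H⟩_{b(i+1)}`
for `i < N`: `log Z_{b N}(H) ≤ log Z_{b 0}(H) − Σ_{i<N} (b(i+1) − b i)·E' (i+1)`. Proof: telescope the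
supporting lines at the RIGHT endpoints, `log Z_{b i} ≥ log Z_{b(i+1)} + (b(i+1) − b i) Re⟨H⟩_{b(i+1)}`
(the right Riemann sum); our telescoping of the cited variational inequality with trial states
`ρ_{b(i+1)}` at `T = 1/b i`. [cite: GustafsonSigal2003, §18.3 (18.12)–(18.13), Problem 18.9] [cite: Ruelle1969, §2.5–2.6 (convexity of log Z in β)] -/
theorem log_partitionFn_le_sub_sum_mul {H : Matrix n n ℂ} (hH : H.IsHermitian) {b : ℕ → ℝ}
    (hb0 : 0 ≤ b 0) (hb : Monotone b) {E' : ℕ → ℝ} (N : ℕ)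
    (hE : ∀ i < N, E' (i + 1) ≤ (gibbsState (b (i + 1)) H H).re) :
    Real.log (partitionFn (b N) H).re ≤
      Real.log (partitionFn (b 0) H).re - ∑ i ∈ Finset.range N, (b (i + 1) - b i) * E' (i + 1) := by
  induction N with
  | zero => simp
  | succ N ih =>
    have hih := ih (fun i hi => hE i (Nat.lt_succ_of_lt hi))
    have hbN1 : 0 ≤ b (N + 1) := hb0.trans (hb (Nat.zero_le _))
    have htan := log_partitionFn_sub_mul_energy_le_of_nonneg hH (b N) hbN1
    have hΔ : 0 ≤ b (N + 1) - b N := sub_nonneg.2 (hb (Nat.le_succ N))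
    have hEN := mul_le_mul_of_nonneg_left (hE N (Nat.lt_succ_self N)) hΔ
    rw [Finset.sum_range_succ]
    nlinarith

end Literature.MathematicalPhysics.QuantumLattice
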